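import Summits.RiemannHypothesis.RiemannHypothesis.Theorems.UniversalFactorMediumUCells

/-!
# RiemannHypothesis / UniversalFactor — tables and context of the certified `H_0` evaluator (soundness, II)

Route `RiemannHypothesis/UniversalFactor`, crux `MediumKernelNoGo` (stmt-RiemannHypothesis-2577), line
`one-sided-average-sign-test`.  Enclosure lemmas for the scalar pieces of the u-side evaluator
(`osaPhiPartial ∋ Φ_N(u)`, `osaPhiMaj ≥ S·PhiMaj`, `osaThetaTail ≥ S·T_N`, `osaUTail ≥ S·tail_U`), the
table invariant of `osaPhiTab`, the error sums `osaErrSums`, and the validity of a constructed context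
(`valid_of_mkOsaCtx`, registered sub-goal `stub_validOfMkOsaCtx`).
-/

set_option linter.dupNamespace false

noncomputable section

namespace Summit.RiemannHypothesis.RiemannHypothesis.Theorems

open MeasureTheory Set
open Literature.NumberTheory.LFunctions
open Literature.Analysis.ValidatedNumerics Literature.Analysis.ValidatedNumerics.NumericsMP

/-! ## Enclosure lemmas for the scalar pieces of the u-side evaluator -/

/-- `q ∈ ofFrac S q.num q.den` for a rational `q`. [folklore] -/
theorem UniversalFactor.osa_mem_ofFracQ (S : ℕ) (q : ℚ) : MI.mem S ((q : ℚ) : ℝ) (MI.ofFrac S q.num q.den) := by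
  have h := MI.mem_ofFrac S q.num q.den_pos
  convert h using 2
  exact Rat.cast_def q

/-- A membership transported along an equality of the real number. [folklore] -/
theorem UniversalFactor.osa_mem_congr {S : ℕ} {x y : ℝ} {I : MI} (h : MI.mem S x I) (e : x = y) : MI.mem S y I :=
  e ▸ h

/-- **The theta partial sum enclosure**: `Φ_n(u) ∈ osaPhiPartial … n` for `u ∈ uI`. [folklore] -/
theorem UniversalFactor.mem_osaPhiPartial {S Kexp kexp : ℕ} (hS : 0 < S) {piI uI : MI} {u : ℝ}
    (hpi : MI.mem S Real.pi piI) (hu : MI.mem S u uI) :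
    ∀ (n : ℕ) {v : MI}, UniversalFactor.osaPhiPartial S Kexp kexp piI uI n = some v →
      MI.mem S (UniversalFactor.osaPhiN n u) v
  | 0, v, h => by
      simp only [UniversalFactor.osaPhiPartial, Option.some.injEq] at h
      subst h
      simp only [UniversalFactor.osaPhiN, Finset.range_zero, Finset.sum_empty]
      exact_mod_cast MI.mem_ofInt S 0
  | n + 1, v, h => by
      simp only [UniversalFactor.osaPhiPartial] at h
      split at h
      · rename_i acc e9 e5 e4 hacc he9 he5 he4
        split at h
        · rename_i g hg
          simp only [Option.some.injEq] at h
          subst h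
          have ih := UniversalFactor.mem_osaPhiPartial hS hpi hu n hacc
          have m9 := MI.mem_exp hS he9 (MI.mem_mulInt hu 9)
          have m5 := MI.mem_exp hS he5 (MI.mem_mulInt hu 5)
          have m4 := MI.mem_exp hS he4 (MI.mem_mulInt hu 4)
          have mpi2 := MI.mem_mul hS hpi hpi
          set m : ℤ := (n : ℤ) + 1 with hm
          have mpoly := MI.mem_sub (MI.mem_mul hS (MI.mem_mulInt mpi2 (2 * m ^ 4)) m9)
            (MI.mem_mul hS (MI.mem_mulInt hpi (3 * m ^ 2)) m5)
          have mg := MI.mem_exp hS hg (MI.mem_neg (MI.mem_mul hS (MI.mem_mulInt hpi (m ^ 2)) m4))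
          have := MI.mem_add ih (MI.mem_mul hS mpoly mg)
          refine UniversalFactor.osa_mem_congr this ?_
          rw [UniversalFactor.osaPhiN, UniversalFactor.osaPhiN, Finset.sum_range_succ, deBruijnPhiSummand, hm]
          push_cast
          ring_nf
        · simp at h
      · simp at h

/-- **The disc majorant bound**: `PhiMaj(u_c, R) · S ≤ osaPhiMaj … c n`. [folklore] -/
theorem UniversalFactor.le_osaPhiMaj {S Kexp kexp : ℕ} (hS : 0 < S) {piI : MI} (hpi : MI.mem S Real.pi piI)
    (ρ R : ℚ) (c : ℕ) :
    ∀ (n : ℕ) {M : ℤ}, UniversalFactor.osaPhiMaj S Kexp kexp piI ρ R c n = some M →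
      UniversalFactor.osaPhiMajR n ((2 * c + 1) * (ρ : ℝ)) (R : ℝ) * S ≤ M
  | 0, M, h => by
      simp only [UniversalFactor.osaPhiMaj, Option.some.injEq] at h
      subst h
      simp [UniversalFactor.osaPhiMajR]
  | n + 1, M, h => by
      simp only [UniversalFactor.osaPhiMaj] at h
      split at h
      · rename_i acc e9 e5 e4 hacc he9 he5 he4
        split at h
        · rename_i g hg
          simp only [Option.some.injEq] at h
          subst h
          have ih := UniversalFactor.le_osaPhiMaj hS hpi ρ R c n hacc
          have m9 := MI.mem_exp hS he9 (UniversalFactor.osa_mem_ofFracQ S _)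
          have m5 := MI.mem_exp hS he5 (UniversalFactor.osa_mem_ofFracQ S _)
          have m4 := MI.mem_exp hS he4 (UniversalFactor.osa_mem_ofFracQ S _)
          have mpi2 := MI.mem_mul hS hpi hpi
          set m : ℤ := (n : ℤ) + 1 with hm
          have mpoly := MI.mem_add (MI.mem_mul hS (MI.mem_mulInt mpi2 (2 * m ^ 4)) m9)
            (MI.mem_mul hS (MI.mem_mulInt hpi (3 * m ^ 2)) m5)
          have mg := MI.mem_exp hS hg (MI.mem_neg (MI.mem_mul hS (MI.mem_mul hS (MI.mem_mulInt hpi (m ^ 2)) m4)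
            (UniversalFactor.osa_mem_ofFracQ S _)))
          have hterm := (MI.mem_mul hS mpoly mg).2
          rw [UniversalFactor.osaPhiMajR, Finset.sum_range_succ, ← UniversalFactor.osaPhiMajR, add_mul]
          push_cast
          refine add_le_add ih (le_of_eq_of_le ?_ hterm)
          rw [hm]; push_cast; ring_nf
        · simp at h
      · simp at h

/-- **The theta tail bound**: `T_N(u) · S ≤ osaThetaTail … N u`. [folklore] -/
theorem UniversalFactor.le_osaThetaTail {S Kexp kexp : ℕ} (hS : 0 < S) {piI : MI} (hpi : MI.mem S Real.pi piI)
    (N : ℕ) (u : ℚ) {T : ℤ} (h : UniversalFactor.osaThetaTail S Kexp kexp piI N u = some T) :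
    UniversalFactor.osaThetaT N (u : ℝ) * S ≤ T := by
  simp only [UniversalFactor.osaThetaTail] at h
  split at h
  · rename_i e9 e4 he9 he4
    split at h
    · rename_i g hg
      simp only [Option.some.injEq] at h
      subst h
      have m9 := MI.mem_exp hS he9 (UniversalFactor.osa_mem_ofFracQ S _)
      have m4 := MI.mem_exp hS he4 (UniversalFactor.osa_mem_ofFracQ S _)
      have mpi2 := MI.mem_mul hS hpi hpi
      set m : ℤ := (N : ℤ) + 1 with hm
      have mg := MI.mem_exp hS hg (MI.mem_neg (MI.mem_mul hS (MI.mem_mulInt hpi (m ^ 2)) m4))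
      have hterm := (MI.mem_mul hS (MI.mem_mul hS (MI.mem_mulInt mpi2 (4 * m ^ 4)) m9) mg).2
      refine le_of_eq_of_le ?_ hterm
      rw [UniversalFactor.osaThetaT, hm]; push_cast; ring_nf
    · simp at h
  · simp at h

/-- **The `u`-tail bound**: `50 e^{9U−πe^{4U}}/(4πe^{4U}−9) · S ≤ osaUTail … U` for `U ≥ 0`. [folklore] -/
theorem UniversalFactor.le_osaUTail {S Kexp kexp : ℕ} (hS : 0 < S) {piI : MI} (hpi : MI.mem S Real.pi piI)
    {U : ℚ} (hU : 0 ≤ U) {T : ℤ} (h : UniversalFactor.osaUTail S Kexp kexp piI U = some T) :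
    50 * Real.exp (9 * (U : ℝ) - Real.pi * Real.exp (4 * (U : ℝ))) / (4 * Real.pi * Real.exp (4 * (U : ℝ)) - 9) * S
      ≤ T := by
  simp only [UniversalFactor.osaUTail] at h
  split at h
  · rename_i e4 he4
    split at h
    · rename_i g hg
      simp only [Option.some.injEq] at h
      subst h
      have m4 := MI.mem_exp hS he4 (UniversalFactor.osa_mem_ofFracQ S _)
      have mg := MI.mem_exp hS hg (MI.mem_sub (UniversalFactor.osa_mem_ofFracQ S _) (MI.mem_mul hS hpi m4))
      have h50 := (MI.mem_mulInt mg 50).2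
      have hπ : 3 < Real.pi := Real.pi_gt_three
      have he1 : 1 ≤ Real.exp (4 * (U : ℝ)) := Real.one_le_exp (by positivity)
      have hden : 3 ≤ 4 * Real.pi * Real.exp (4 * (U : ℝ)) - 9 := by nlinarith
      set Ex := Real.exp (9 * (U : ℝ) - Real.pi * Real.exp (4 * (U : ℝ))) with hEx
      have hEx0 : 0 ≤ Ex := (Real.exp_pos _).le
      have hc := Numerics.le_cdiv_mul_real (a := (g.mulInt 50).hi) (b := 3) (by norm_num)
      have h1 : 50 * Ex / (4 * Real.pi * Real.exp (4 * (U : ℝ)) - 9) * S ≤ 50 * Ex / 3 * S := by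
        have : 50 * Ex / (4 * Real.pi * Real.exp (4 * (U : ℝ)) - 9) ≤ 50 * Ex / 3 :=
          div_le_div_of_nonneg_left (by positivity) (by norm_num) hden
        exact mul_le_mul_of_nonneg_right this (Nat.cast_nonneg S)
      refine h1.trans ?_
      have h2 : Ex * 50 * S ≤ ((g.mulInt 50).hi : ℝ) := by
        have := h50; push_cast at this; linarith
      push_cast at hc
      nlinarith
    · simp at h
  · simp at h

/-! ## The tables of a context -/

/-- The true value enclosed by the flat table entry `i = c*32 + j`. [folklore] -/
theorem UniversalFactor.osaPhiTab_inv {S Kexp kexp : ℕ} (hS : 0 < S) {piI : MI} (hpi : MI.mem S Real.pi piI)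
    (ρ : ℚ) (N : ℕ) :
    ∀ (fuel i : ℕ) (arr : Array MI) {tab : Array MI},
      UniversalFactor.osaPhiTab S Kexp kexp piI ρ N fuel i arr = some tab → arr.size = i →
      (∀ i' < i, MI.mem S ((ρ : ℝ) * UniversalFactor.osaWeightR (i' % 32) *
          UniversalFactor.osaPhiN N ((2 * (i' / 32 : ℕ) + 1) * (ρ : ℝ) + (ρ : ℝ) * UniversalFactor.osaNodeR (i' % 32)))
          (arr.getD i' (MI.ofInt S 0))) →
      tab.size = i + fuel ∧
      ∀ i' < i + fuel, MI.mem S ((ρ : ℝ) * UniversalFactor.osaWeightR (i' % 32) *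
          UniversalFactor.osaPhiN N ((2 * (i' / 32 : ℕ) + 1) * (ρ : ℝ) + (ρ : ℝ) * UniversalFactor.osaNodeR (i' % 32)))
          (tab.getD i' (MI.ofInt S 0))
  | 0, i, arr, tab, h, hsz, hP => by
      simp only [UniversalFactor.osaPhiTab, Option.some.injEq] at h
      subst h
      exact ⟨by simpa using hsz, by simpa using hP⟩
  | fuel + 1, i, arr, tab, h, hsz, hP => by
      simp only [UniversalFactor.osaPhiTab] at h
      split at h
      · rename_i v hv
        have hv' := UniversalFactor.mem_osaPhiPartial hS hpi (UniversalFactor.osa_mem_ofFracQ S _) N hv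
        have ih := UniversalFactor.osaPhiTab_inv hS hpi ρ N fuel (i + 1) _ h (by simp [hsz]) ?_
        · refine ⟨by rw [ih.1]; ring, fun i' hi' => ih.2 i' (by omega)⟩
        · intro i' hi'
          simp only [Array.getD_eq_getD_getElem?, Array.getElem?_push]
          by_cases he : i' = i
          · subst he
            simp only [hsz, if_true, Option.getD_some]
            have := MI.mem_mul hS hv' (UniversalFactor.osa_mem_ofFracQ S (ρ * UniversalFactor.osaWeightQ (i' % 32)))
            refine UniversalFactor.osa_mem_congr this ?_
            simp only [UniversalFactor.osaWeightQ, UniversalFactor.osaNodeQ, UniversalFactor.osaWeightR,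
              UniversalFactor.osaNodeR]
            push_cast
            ring
          · have hlt : i' < i := by omega
            simp only [hsz, he, if_false]
            have := hP i' hlt
            simp only [Array.getD_eq_getD_getElem?] at this
            exact this
      · simp at h

/-- The disc majorant is nonnegative. [folklore] -/
theorem UniversalFactor.osaPhiMajR_nonneg (N : ℕ) (uc R : ℝ) : 0 ≤ UniversalFactor.osaPhiMajR N uc R :=
  Finset.sum_nonneg fun n _ => by positivity

/-- The theta tail bound is nonnegative. [folklore] -/
theorem UniversalFactor.osaThetaT_nonneg (N : ℕ) (u : ℝ) : 0 ≤ UniversalFactor.osaThetaT N u := by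
  unfold UniversalFactor.osaThetaT; positivity

/-- The error sums: `Σ_{c ≤ c' < c+fuel} PhiMaj_{c'} · S ≤ sm − acc.1` and `Σ T_N(2c'ρ) · S ≤ st − acc.2`. [folklore] -/
theorem UniversalFactor.osaErrSums_inv {S Kexp kexp : ℕ} (hS : 0 < S) {piI : MI} (hpi : MI.mem S Real.pi piI)
    (ρ R : ℚ) (N : ℕ) :
    ∀ (fuel c : ℕ) (acc : ℤ × ℤ) {r : ℤ × ℤ},
      UniversalFactor.osaErrSums S Kexp kexp piI ρ R N fuel c acc = some r →
      (∑ c' ∈ Finset.Ico c (c + fuel), UniversalFactor.osaPhiMajR N ((2 * (c' : ℝ) + 1) * (ρ : ℝ)) (R : ℝ)) * S ≤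
          r.1 - acc.1 ∧
      (∑ c' ∈ Finset.Ico c (c + fuel), UniversalFactor.osaThetaT N (2 * (c' : ℝ) * (ρ : ℝ))) * S ≤ r.2 - acc.2
  | 0, c, acc, r, h => by
      simp only [UniversalFactor.osaErrSums, Option.some.injEq] at h
      subst h; simp
  | fuel + 1, c, acc, r, h => by
      simp only [UniversalFactor.osaErrSums] at h
      split at h
      · rename_i m t hm ht
        have ih := UniversalFactor.osaErrSums_inv hS hpi ρ R N fuel (c + 1) _ h
        have h1 := UniversalFactor.le_osaPhiMaj hS hpi ρ R c N hm
        have h2 := UniversalFactor.le_osaThetaTail hS hpi N _ ht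
        have hcc : c < c + (fuel + 1) := by omega
        have e : c + (fuel + 1) = c + 1 + fuel := by ring
        constructor
        · rw [Finset.sum_eq_sum_Ico_succ_bot hcc, e, add_mul]
          have := ih.1
          push_cast at this h1 ⊢
          linarith
        · rw [Finset.sum_eq_sum_Ico_succ_bot hcc, e, add_mul]
          have := ih.2
          push_cast at this h2 ⊢
          linarith
      · simp at h

/-- The rational defect is the real defect. [folklore] -/
theorem UniversalFactor.osaDefectQ_cast (ρ R : ℚ) :
    ((UniversalFactor.osaDefectQ ρ R : ℚ) : ℝ) = UniversalFactor.osaDefectR (ρ : ℝ) (R : ℝ) := by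
  simp only [UniversalFactor.osaDefectQ, UniversalFactor.osaDefectR, UniversalFactor.osaWeightQ,
    UniversalFactor.osaNodeQ, UniversalFactor.osaWeightR, UniversalFactor.osaNodeR]
  push_cast
  rfl

/-- The real defect is nonnegative when `0 ≤ ρ < R`. [folklore] -/
theorem UniversalFactor.osaDefectR_nonneg {ρ R : ℝ} (hρ : 0 ≤ ρ) (hρR : ρ < R) :
    0 ≤ UniversalFactor.osaDefectR ρ R := by
  have hR : 0 < R := lt_of_le_of_lt hρ hρR
  have h1 : 0 ≤ 1 - ρ / R := by rw [sub_nonneg, div_le_one hR]; exact hρR.le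
  unfold UniversalFactor.osaDefectR
  refine add_nonneg (Finset.sum_nonneg fun n _ => by positivity) ?_
  refine mul_nonneg (add_nonneg (by linarith) (Finset.sum_nonneg fun j _ => abs_nonneg _)) ?_
  exact div_nonneg (by positivity) h1

/-- **Validity of a constructed context.** [folklore] -/
theorem UniversalFactor.valid_of_mkOsaCtx {p Kpi Kexp kexp rhoUn rhoUd RUn RUd Cu N : ℕ}
    {C : UniversalFactor.OsaCtx}
    (h : UniversalFactor.mkOsaCtx p Kpi Kexp kexp rhoUn rhoUd RUn RUd Cu N = some C)
    (hrho : 0 < rhoUn) (hrhod : 0 < rhoUd) (hRn : 0 < RUn) (hRd : 0 < RUd) (hR4 : 4 * RUn ≤ RUd)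
    (hρR : rhoUn * RUd < RUn * rhoUd) (hN : 1 ≤ N) : C.Valid := by
  simp only [UniversalFactor.mkOsaCtx] at h
  split at h
  · simp at h
  · rename_i piI hpiI
    split at h
    · rename_i tab sm st tu htab hsums htu
      simp only [Option.some.injEq] at h
      subst h
      have hS : 0 < 2 ^ p := Nat.two_pow_pos p
      have hpi := MI.mem_pi (2 ^ p) hpiI
      set ρq : ℚ := (rhoUn : ℚ) / rhoUd with hρq
      set Rq : ℚ := (RUn : ℚ) / RUd with hRq
      have hρ : ((ρq : ℚ) : ℝ) = (rhoUn : ℝ) / rhoUd := by rw [hρq]; push_cast; rfl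
      have hR : ((Rq : ℚ) : ℝ) = (RUn : ℝ) / RUd := by rw [hRq]; push_cast; rfl
      have hρ0 : (0 : ℝ) ≤ (rhoUn : ℝ) / rhoUd := by positivity
      have hρR' : (rhoUn : ℝ) / rhoUd < (RUn : ℝ) / RUd := by
        rw [div_lt_div_iff₀ (by exact_mod_cast hrhod) (by exact_mod_cast hRd)]; exact_mod_cast hρR
      have htab' := UniversalFactor.osaPhiTab_inv hS hpi ρq N (32 * Cu) 0 #[] htab rfl (fun i' hi' => absurd hi' (by omega))
      have hsums' := UniversalFactor.osaErrSums_inv hS hpi ρq Rq N Cu 0 (0, 0) hsums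
      have hU0 : (0 : ℚ) ≤ 2 * Cu * ρq := by rw [hρq]; positivity
      have htu' := UniversalFactor.le_osaUTail hS hpi hU0 htu
      have hD0 : 0 ≤ UniversalFactor.osaDefectR ((rhoUn : ℝ) / rhoUd) ((RUn : ℝ) / RUd) :=
        UniversalFactor.osaDefectR_nonneg hρ0 hρR'
      -- errA
      have hsm : (∑ c ∈ Finset.range Cu, UniversalFactor.osaPhiMajR N ((2 * c + 1) * ((rhoUn : ℝ) / rhoUd))
          ((RUn : ℝ) / RUd)) * (2 ^ p : ℕ) ≤ sm := by
        have := hsums'.1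
        rw [zero_add, ← Finset.range_eq_Ico, hρ, hR] at this
        push_cast at this ⊢
        linarith
      have hst : (∑ c ∈ Finset.range Cu, UniversalFactor.osaThetaT N (2 * c * ((rhoUn : ℝ) / rhoUd))) *
          (2 ^ p : ℕ) ≤ st := by
        have := hsums'.2
        rw [zero_add, ← Finset.range_eq_Ico, hρ] at this
        push_cast at this ⊢
        linarith
      have hsm0 : (0 : ℝ) ≤ (sm : ℝ) := by
        refine le_trans (mul_nonneg (Finset.sum_nonneg fun c _ => UniversalFactor.osaPhiMajR_nonneg _ _ _) ?_) hsm
        positivity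
      refine ⟨hS, hpi, hrho, hrhod, hRn, hRd, hR4, hρR, hN, ?_, ?_, ?_, ?_⟩
      · intro c j hc hj
        dsimp only at hc ⊢
        have := htab'.2 (c * 32 + j) (by omega)
        have e1 : (c * 32 + j) % 32 = j := by omega
        have e2 : (c * 32 + j) / 32 = c := by omega
        rw [e1, e2] at this
        simpa [UniversalFactor.OsaCtx.rho, hρ] using this
      · -- 0 ≤ errA
        dsimp only
        have hdA : (0 : ℚ) ≤ UniversalFactor.osaDefectQ ρq Rq * sm := by
          have h1 : (0 : ℝ) ≤ ((UniversalFactor.osaDefectQ ρq Rq : ℚ) : ℝ) := by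
            rw [UniversalFactor.osaDefectQ_cast, hρ, hR]; exact hD0
          have : (0 : ℝ) ≤ ((UniversalFactor.osaDefectQ ρq Rq * sm : ℚ) : ℝ) := by push_cast; exact mul_nonneg h1 hsm0
          exact_mod_cast this
        have hc := Numerics.le_cdiv_mul_real (a := (UniversalFactor.osaDefectQ ρq Rq * sm).num)
          (b := (UniversalFactor.osaDefectQ ρq Rq * sm).den) (by exact_mod_cast Rat.den_pos _)
        push_cast at hc
        have hnum : (0 : ℝ) ≤ ((UniversalFactor.osaDefectQ ρq Rq * sm).num : ℝ) := by
          exact_mod_cast Rat.num_nonneg.2 hdA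
        have hden : (0 : ℝ) < ((UniversalFactor.osaDefectQ ρq Rq * sm).den : ℝ) := by exact_mod_cast Rat.den_pos _
        have : (0 : ℝ) ≤ (Numerics.cdiv (UniversalFactor.osaDefectQ ρq Rq * sm).num
            (UniversalFactor.osaDefectQ ρq Rq * sm).den : ℝ) := by
          by_contra hneg; push Not at hneg; nlinarith
        have hz : (0 : ℤ) ≤ Numerics.cdiv (UniversalFactor.osaDefectQ ρq Rq * sm).num
            (UniversalFactor.osaDefectQ ρq Rq * sm).den := by exact_mod_cast this
        linarith
      · -- errA bound
        dsimp only
        simp only [UniversalFactor.OsaCtx.rho, UniversalFactor.OsaCtx.RU]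
        set dA : ℚ := UniversalFactor.osaDefectQ ρq Rq * sm with hdA
        have hc := Numerics.le_cdiv_mul_real (a := dA.num) (b := dA.den) (by exact_mod_cast Rat.den_pos _)
        push_cast at hc
        have hden : (0 : ℝ) < (dA.den : ℝ) := by exact_mod_cast Rat.den_pos _
        have hdAR : ((dA : ℚ) : ℝ) = UniversalFactor.osaDefectR ((rhoUn : ℝ) / rhoUd) ((RUn : ℝ) / RUd) * sm := by
          rw [hdA]; push_cast; rw [UniversalFactor.osaDefectQ_cast, hρ, hR]
        have hq : ((dA : ℚ) : ℝ) = (dA.num : ℝ) / dA.den := Rat.cast_def dA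
        have hSpos : (0 : ℝ) < ((2 ^ p : ℕ) : ℝ) := by exact_mod_cast hS
        rw [le_div_iff₀ hSpos]
        push_cast
        have h1 : UniversalFactor.osaDefectR ((rhoUn : ℝ) / rhoUd) ((RUn : ℝ) / RUd) *
            (∑ c ∈ Finset.range Cu, UniversalFactor.osaPhiMajR N ((2 * c + 1) * ((rhoUn : ℝ) / rhoUd))
              ((RUn : ℝ) / RUd)) * (2 : ℝ) ^ p ≤ ((dA : ℚ) : ℝ) := by
          rw [hdAR, mul_assoc]
          refine mul_le_mul_of_nonneg_left ?_ hD0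
          push_cast at hsm; exact hsm
        have h2 : ((dA : ℚ) : ℝ) ≤ (Numerics.cdiv dA.num dA.den : ℝ) := by
          rw [hq, div_le_iff₀ hden]; exact hc
        linarith
      · -- errB bound
        dsimp only
        simp only [UniversalFactor.OsaCtx.rho]
        set dB : ℚ := 2 * ρq * st with hdB
        have hc := Numerics.le_cdiv_mul_real (a := dB.num) (b := dB.den) (by exact_mod_cast Rat.den_pos _)
        push_cast at hc
        have hden : (0 : ℝ) < (dB.den : ℝ) := by exact_mod_cast Rat.den_pos _
        have hq : ((dB : ℚ) : ℝ) = (dB.num : ℝ) / dB.den := Rat.cast_def dB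
        have hdBR : ((dB : ℚ) : ℝ) = 2 * ((rhoUn : ℝ) / rhoUd) * st := by rw [hdB]; push_cast; rw [hρ]
        have hSpos : (0 : ℝ) < ((2 ^ p : ℕ) : ℝ) := by exact_mod_cast hS
        rw [le_div_iff₀ hSpos]
        have hU : (((2 * Cu * ρq : ℚ)) : ℝ) = 2 * Cu * ((rhoUn : ℝ) / rhoUd) := by push_cast; rw [hρ]
        rw [hU] at htu'
        push_cast at hst htu' ⊢
        have h1 : 2 * ((rhoUn : ℝ) / rhoUd) * (∑ c ∈ Finset.range Cu, UniversalFactor.osaThetaT N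
            (2 * c * ((rhoUn : ℝ) / rhoUd))) * (2 : ℝ) ^ p ≤ ((dB : ℚ) : ℝ) := by
          rw [hdBR, mul_assoc]
          exact mul_le_mul_of_nonneg_left hst (by positivity)
        have h2 : ((dB : ℚ) : ℝ) ≤ (Numerics.cdiv dB.num dB.den : ℝ) := by
          rw [hq, div_le_iff₀ hden]; exact hc
        nlinarith
    · simp at h

/-- **Registered sub-goal `stub_validOfMkOsaCtx`** (validity of a constructed context). [folklore] -/
theorem UniversalFactor.stub_validOfMkOsaCtx :
    ∀ (p Kpi Kexp kexp rhoUn rhoUd RUn RUd Cu N : ℕ) (C : UniversalFactor.OsaCtx),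
      UniversalFactor.mkOsaCtx p Kpi Kexp kexp rhoUn rhoUd RUn RUd Cu N = some C →
      0 < rhoUn → 0 < rhoUd → 0 < RUn → 0 < RUd → 4 * RUn ≤ RUd → rhoUn * RUd < RUn * rhoUd → 1 ≤ N → C.Valid :=
  fun _ _ _ _ _ _ _ _ _ _ _ h => UniversalFactor.valid_of_mkOsaCtx h

end Summit.RiemannHypothesis.RiemannHypothesis.Theorems
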